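import Literature.AnabelianGeometry.AbsoluteAnabelian.AbsTopII.TwoTripodNodalFixedSubgroupGen
import HarnessLib

/-!
# [AbsTopII] Prop 1.3 (viii) at the two-vertex nodal datum, V: KeyGen at both vertices and the typed `Prop_1_3_viii'`

S. Mochizuki, *Topics in Absolute Anabelian Geometry II* [AbsTopII] (bib `MochizukiAbsTopII2013`; locators =
PDF pages of the kurims manuscript `paper:url-585b8d0ad0d9`), §1 Prop 1.3 (viii) p. 12 (and (iv)/(v): the inertia
group of a vertex acts with fixed locus that vertex).

PROOF-ONLY companion of `AbsTopII/TwoTripodNodalDatum.lean` (abc-iut-f-066 gen 6, follow-on «P13viii-TWO-VERTEX»), part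
V over part IV (`mem_closure_of_commute_gen`).  At `M.dpsc` (two tripods `v_A`, `v_B`, ONE non-loop node, inertia
sections `T = I_{v_A}`, `U = I_{v_B}`; every `Σ`):

* `hom_int_twist_invariant` — every character `Γ_{0,4} → ℤ` is invariant under the Dehn twist;
* `exists_character_Tside` / `exists_character_Uside` — the two continuous characters `P → T` feeding part IV
  (`c₁ ↦ t₀`, `c₂, c₃ ↦ 1`, identity on `T`, trivial on `U`; resp. `c₃ ↦ t₀`, `c₀, c₁ ↦ 1`, trivial on `T`, injective
  on `U` — the latter through the retraction `P → T`, p466644);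
* `mem_vertGpA_of_commute_T`, `mem_vertGpB_of_commute_U` — **KeyGen: an element of `Π_𝔾` commuting with ANY
  non-trivial element of `I_{v_A}` (resp. `I_{v_B}`) lies in `Π_{v_A}` (resp. `Π_{v_B}`)**, every `Σ`, no hypothesis;
* `prop_1_3_viii'_dpsc` — **[AbsTopII] Prop 1.3 (viii) AS TYPED (`DPSCIndexData.Prop_1_3_viii'`, F-0301-class) HOLDS at
  the two-vertex nodal datum, NO hypothesis** (part III's `prop_1_3_viii'_dpsc_of_keyGen` with KeyGen discharged);
  `exists_twoVertex_nodal_model_viii` — ONE datum with two vertices carrying the typed (i), (ii′), (iii), (iii′), (iv′),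
  (iv)-«Moreover», (v), (v′), (vi), (vii), (viii′), (ix) simultaneously.
HONEST FRAMING: classical profinite group theory at a constructed model (constructed ≠ geometric); consistency evidence
for typed rows, not a discharge at geometric data; nothing here bears on [IUTchIII] Cor 3.12; no side taken.
-/

noncomputable section

open scoped Pointwise

namespace Literature.AnabelianGeometry.AbsoluteAnabelian.AbsTopII.TwoTripodNodal.Model

open Literature.AnabelianGeometry.SemiGraphs
open Literature.AnabelianGeometry.SemiGraphs.SemiGraphOfAnabelioids (IsProSigmaCompletion)
open Literature.AnabelianGeometry.SemiGraphs.SemiGraphOfAnabelioids.IsProSigmaCompletion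
open Literature.AnabelianGeometry.Anabelioids (IsSigmaInteger)
open Literature.GroupTheory.CombinatorialGroupTheory
open Literature.GroupTheory.CombinatorialGroupTheory.PuncturedSurfaceGroup
open Literature.GroupTheory.CombinatorialGroupTheory.FreeFactorFibredTwist (lift_apply_basis)
open _root_.Topology

variable {Sigma : Set ℕ} (M : Model Sigma)

/-! ### Characters of `Γ_{0,4}` are twist-invariant -/

/-- Every character `Γ_{0,4} → ℤ` is invariant under the Dehn twist `φ` (the twist fixes `c₁, c₂` and conjugates
`c₃`). [cite: MochizukiAbsTopII2013, Def 1.2 (ii) p.10] -/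
theorem hom_int_twist_invariant (f : PuncturedSurfaceGroup 0 4 →* Multiplicative ℤ) :
    ∀ (g : Multiplicative ℤ) (x : PuncturedSurfaceGroup 0 4), f (M.φ g x) = f x := by
  obtain ⟨b, hb⟩ := exists_freeGroupBasis_succ
  have h1 : f.comp (M.φ (Multiplicative.ofAdd (1 : ℤ))).toMonoidHom = f := by
    refine b.ext_hom _ _ fun j => ?_
    rw [MonoidHom.comp_apply, MulEquiv.coe_toMonoidHom, hb]
    fin_cases j
    · show f (M.φ _ (c 1)) = f (c 1); rw [M.twist_c_one]
    · show f (M.φ _ (c 2)) = f (c 2); rw [M.twist_c_two]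
    · show f (M.φ _ (c 3)) = f (c 3)
      rw [M.twist_c_three, map_mul, map_mul, map_inv, mul_inv_cancel_comm]
  intro g x
  let S : Subgroup (Multiplicative ℤ) :=
    { carrier := {g | ∀ x, f (M.φ g x) = f x}
      one_mem' := fun x => by simp
      mul_mem' := fun {a b} ha hb x => by
        change f (M.φ (a * b) x) = f x
        rw [map_mul, MulAut.mul_apply, ha, hb]
      inv_mem' := fun {a} ha x => by
        change f (M.φ a⁻¹ x) = f x
        have := ha (M.φ a⁻¹ x)
        rw [map_inv, MulAut.apply_inv_self] at this
        rw [map_inv]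
        exact this.symm }
  have hmem : Multiplicative.ofAdd (1 : ℤ) ∈ S := fun x => DFunLike.congr_fun h1 x
  have hle : Subgroup.zpowers (Multiplicative.ofAdd (1 : ℤ)) ≤ S := (Subgroup.zpowers_le).mpr hmem
  have hg : g ∈ Subgroup.zpowers (Multiplicative.ofAdd (1 : ℤ)) :=
    ⟨Multiplicative.toAdd g, by
      change Multiplicative.ofAdd (1 : ℤ) ^ Multiplicative.toAdd g = g
      rw [← ofAdd_zsmul, smul_eq_mul, mul_one, ofAdd_toAdd]⟩
  exact hle hg x

/-- The pro-`Σ` completion map `ℤ → T` with all its values (`n ↦ ι(inr n)`). [cite: MochizukiAbsTopII2013, Prop 1.3 (iii) p.11] -/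
theorem exists_kappaT_all : ∃ κ : Multiplicative ℤ →* ↥M.T, IsProSigmaCompletion Sigma κ ∧
    ∀ n, ((κ n : ↥M.T) : M.P) = M.ι (SemidirectProduct.inr n) :=
  ⟨((Subgroup.inclusion (Subgroup.le_topologicalClosure
      ((SemidirectProduct.inr : Multiplicative ℤ →* PuncturedSurfaceGroup 0 4 ⋊[M.φ] Multiplicative ℤ).range.map M.ι))).comp
      (M.ι.subgroupMap (SemidirectProduct.inr : Multiplicative ℤ →* PuncturedSurfaceGroup 0 4 ⋊[M.φ] Multiplicative ℤ).range)).comp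
      (MonoidHom.ofInjective (SemidirectProduct.inr_injective (φ := M.φ))).toMonoidHom,
    SemidirectCofinal.isProSigmaCompletion_closure_inr M.φ M.isProSigmaCompletion, fun _ => rfl⟩

/-- No non-trivial element of `T` has finite order. [cite: MochizukiAbsTopII2013, Prop 1.3 (iii) p.11] -/
theorem pow_ne_one_of_mem_T {s : M.P} (hs : s ∈ M.T) (hs1 : s ≠ 1) {n : ℕ} (hn : 0 < n) : s ^ n ≠ 1 := by
  intro h
  haveI : CompactSpace ↥M.T := isCompact_iff_compactSpace.mp (Subgroup.isClosed_topologicalClosure _).isCompact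
  have hfin : IsOfFinOrder (⟨s, hs⟩ : ↥M.T) :=
    isOfFinOrder_iff_pow_eq_one.mpr ⟨n, hn, Subtype.ext (by rw [SubmonoidClass.coe_pow]; exact h)⟩
  have := M.isFreeProSigmaCyclic_T.eq_one_of_isOfFinOrder hfin
  exact hs1 (congrArg Subtype.val this)

/-- No non-trivial element of `U` has finite order. [cite: MochizukiAbsTopII2013, Prop 1.3 (iii) p.11] -/
theorem pow_ne_one_of_mem_U (hne : Sigma.Nonempty) (hprime : ∀ p ∈ Sigma, p.Prime) {s : M.P} (hs : s ∈ M.U)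
    (hs1 : s ≠ 1) {n : ℕ} (hn : 0 < n) : s ^ n ≠ 1 := by
  intro h
  haveI : CompactSpace ↥M.U := isCompact_iff_compactSpace.mp (Subgroup.isClosed_topologicalClosure _).isCompact
  have hfin : IsOfFinOrder (⟨s, hs⟩ : ↥M.U) :=
    isOfFinOrder_iff_pow_eq_one.mpr ⟨n, hn, Subtype.ext (by rw [SubmonoidClass.coe_pow]; exact h)⟩
  have := (M.isFreeProSigmaCyclic_U hne hprime).eq_one_of_isOfFinOrder hfin
  exact hs1 (congrArg Subtype.val this)

/-! ### The two characters -/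

/-- **The `T`-side character**: a continuous `χ : P → T` with `χ(ι c₁) = t₀`, `χ(ι c₂) = χ(ι c₃) = 1`, the identity on
`T` and trivial on `U` (extension of `inl d ↦ f(d)`, `inr n ↦ n` with `f = (c₁ ↦ 1, c₂ ↦ 0, c₃ ↦ 0)`).
[cite: MochizukiAbsTopII2013, Prop 1.3 (iv) p.11] -/
theorem exists_character_Tside : ∃ χ : M.P →* ↥M.T, Continuous χ ∧
    χ (M.ι (SemidirectProduct.inl (c 1))) = ⟨M.ι (SemidirectProduct.inr (Multiplicative.ofAdd (1 : ℤ))), M.t0_mem_T⟩ ∧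
    χ (M.ι (SemidirectProduct.inl (c 2))) = 1 ∧ χ (M.ι (SemidirectProduct.inl (c 3))) = 1 ∧
    (∀ t (ht : t ∈ M.T), χ t = ⟨t, ht⟩) ∧ ∀ u ∈ M.U, χ u = 1 := by
  haveI : CompactSpace ↥M.T := isCompact_iff_compactSpace.mp (Subgroup.isClosed_topologicalClosure _).isCompact
  obtain ⟨κ, hκ, hκv⟩ := M.exists_kappaT_all
  obtain ⟨b, hb⟩ := exists_freeGroupBasis_succ
  have hb0 : b 0 = c 1 := hb 0
  have hb1 : b 1 = c 2 := hb 1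
  have hb2 : b 2 = c 3 := hb 2
  let f : PuncturedSurfaceGroup 0 4 →* Multiplicative ℤ := b.lift ![Multiplicative.ofAdd 1, 1, 1]
  have hfb : ∀ j, f (b j) = ![Multiplicative.ofAdd (1 : ℤ), 1, 1] j := fun j => lift_apply_basis b _ j
  have hf1 : f (c 1) = Multiplicative.ofAdd 1 := by rw [← hb0, hfb]; rfl
  have hf2 : f (c 2) = 1 := by rw [← hb1, hfb]; rfl
  have hf3 : f (c 3) = 1 := by rw [← hb2, hfb]; rfl
  have hfinv := M.hom_int_twist_invariant f
  let g₀ : (PuncturedSurfaceGroup 0 4 ⋊[M.φ] Multiplicative ℤ) →* Multiplicative ℤ :=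
    SemidirectProduct.lift f (MonoidHom.id _) fun g => by
      ext x
      simp only [MonoidHom.comp_apply, MulEquiv.coe_toMonoidHom, MulAut.conj_apply, MonoidHom.id_apply,
        mul_inv_cancel_comm, hfinv]
  obtain ⟨G, hGc, hGι⟩ := exists_continuous_extend_profinite M.isProSigmaCompletion hκ.index_open (κ.comp g₀)
  refine ⟨G, hGc, ?_, ?_, ?_, ?_, ?_⟩
  · rw [hGι, MonoidHom.comp_apply, SemidirectProduct.lift_inl, hf1]
    exact Subtype.ext (hκv _)
  · rw [hGι, MonoidHom.comp_apply, SemidirectProduct.lift_inl, hf2, map_one]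
  · rw [hGι, MonoidHom.comp_apply, SemidirectProduct.lift_inl, hf3, map_one]
  · -- identity on `T`
    have h := continuous_extend_profinite_unique hκ (F := G.comp (M.T).subtype) (F' := MonoidHom.id _)
      (hGc.comp continuous_subtype_val) continuous_id fun n => by
        rw [MonoidHom.comp_apply, MonoidHom.id_apply, Subgroup.coe_subtype, hκv, hGι, MonoidHom.comp_apply,
          SemidirectProduct.lift_inr, MonoidHom.id_apply]
    intro t ht
    have := DFunLike.congr_fun h ⟨t, ht⟩
    rw [MonoidHom.comp_apply, MonoidHom.id_apply, Subgroup.coe_subtype] at this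
    exact this
  · -- trivial on `U`
    have hker : IsClosed (G.ker : Set M.P) := by
      rw [MonoidHom.coe_ker]; exact isClosed_singleton.preimage hGc
    have hval : g₀ (SemidirectProduct.inl (c 1 * c 2 : PuncturedSurfaceGroup 0 4)⁻¹ *
        SemidirectProduct.inr (Multiplicative.ofAdd (1 : ℤ))) = 1 := by
      have h1 : g₀ (SemidirectProduct.inl (c 1 * c 2 : PuncturedSurfaceGroup 0 4)⁻¹) = (f (c 1 * c 2))⁻¹ := by
        rw [map_inv, map_inv]
        exact congrArg Inv.inv (SemidirectProduct.lift_inl f (MonoidHom.id _) _ (c 1 * c 2))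
      have h2 : g₀ (SemidirectProduct.inr (Multiplicative.ofAdd (1 : ℤ))) = Multiplicative.ofAdd 1 :=
        SemidirectProduct.lift_inr f (MonoidHom.id _) _ (Multiplicative.ofAdd (1 : ℤ))
      rw [map_mul, h1, h2, map_mul, hf1, hf2, mul_one, inv_mul_cancel]
    have hle : Subgroup.zpowers (M.ι (SemidirectProduct.inl (c 1 * c 2 : PuncturedSurfaceGroup 0 4)⁻¹ *
        SemidirectProduct.inr (Multiplicative.ofAdd (1 : ℤ)))) ≤ G.ker := by
      rw [Subgroup.zpowers_le, MonoidHom.mem_ker, hGι, MonoidHom.comp_apply, hval, map_one]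
    exact fun u hu => (Subgroup.topologicalClosure_minimal _ hle hker) hu

/-- **The `U`-side character**: a continuous `χ : P → T` with `χ(ι c₃) = t₀`, `χ(ι c₀) = χ(ι c₁) = 1`, trivial on `T` and
NON-TRIVIAL on every non-trivial element of `U` (on `U` it agrees with the retraction `P → T`, which is injective there).
[cite: MochizukiAbsTopII2013, Prop 1.3 (iv) p.11] -/
theorem exists_character_Uside (hne : Sigma.Nonempty) (hprime : ∀ p ∈ Sigma, p.Prime) :
    ∃ χ : M.P →* ↥M.T, Continuous χ ∧
    χ (M.ι (SemidirectProduct.inl (c 3))) = ⟨M.ι (SemidirectProduct.inr (Multiplicative.ofAdd (1 : ℤ))), M.t0_mem_T⟩ ∧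
    χ (M.ι (SemidirectProduct.inl (c 0))) = 1 ∧ χ (M.ι (SemidirectProduct.inl (c 1))) = 1 ∧
    (∀ t ∈ M.T, χ t = 1) ∧ ∀ u ∈ M.U, u ≠ 1 → χ u ≠ 1 := by
  haveI : CompactSpace ↥M.T := isCompact_iff_compactSpace.mp (Subgroup.isClosed_topologicalClosure _).isCompact
  obtain ⟨κ, hκ, hκv⟩ := M.exists_kappaT_all
  -- the free basis `(c₃, c₀, c₁)`
  obtain ⟨b₀, hb₀⟩ := exists_freeGroupBasis_succ
  obtain ⟨b, hb⟩ := exists_freeGroupBasis_of_lifts b₀ ![b₀ 2, (b₀ 0 * b₀ 1 * b₀ 2)⁻¹, b₀ 0]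
    ![b₀ 2, (b₀ 2)⁻¹ * (b₀ 1)⁻¹ * (b₀ 0)⁻¹, b₀ 0]
    (fun i => by fin_cases i <;> simp [mul_assoc])
    (fun i => by fin_cases i <;> simp [mul_assoc])
  have hb0 : b 0 = c 3 := by rw [hb]; simp [hb₀]
  have hb1 : b 1 = c 0 := by rw [hb, c_zero_eq_inv]; simp [hb₀]
  have hb2 : b 2 = c 1 := by rw [hb]; simp [hb₀]
  let f : PuncturedSurfaceGroup 0 4 →* Multiplicative ℤ := b.lift ![Multiplicative.ofAdd 1, 1, 1]
  have hfb : ∀ j, f (b j) = ![Multiplicative.ofAdd (1 : ℤ), 1, 1] j := fun j => lift_apply_basis b _ j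
  have hf3 : f (c 3) = Multiplicative.ofAdd 1 := by rw [← hb0, hfb]; rfl
  have hf0 : f (c 0) = 1 := by rw [← hb1, hfb]; rfl
  have hf1 : f (c 1) = 1 := by rw [← hb2, hfb]; rfl
  have hfw : f (c 1 * c 2 : PuncturedSurfaceGroup 0 4)⁻¹ = Multiplicative.ofAdd 1 := by
    have hw : (c 1 * c 2 : PuncturedSurfaceGroup 0 4)⁻¹ = c 3 * c 0 := by rw [c_zero_eq_inv]; group
    rw [hw, map_mul, hf3, hf0, mul_one]
  have hfinv := M.hom_int_twist_invariant f
  let g₀ : (PuncturedSurfaceGroup 0 4 ⋊[M.φ] Multiplicative ℤ) →* Multiplicative ℤ :=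
    SemidirectProduct.lift f 1 fun g => by
      ext x
      simp only [MonoidHom.comp_apply, MulEquiv.coe_toMonoidHom, MonoidHom.one_apply, map_one, MulAut.one_apply,
        hfinv]
  obtain ⟨G, hGc, hGι⟩ := exists_continuous_extend_profinite M.isProSigmaCompletion hκ.index_open (κ.comp g₀)
  -- the retraction, for injectivity on `U`
  obtain ⟨F, hFc, hFι, hFT, hFA⟩ := SemidirectCofinal.exists_retraction M.φ M.isProSigmaCompletion
  have hF1 : ∀ z : M.P, F z = 1 ↔ z ∈ M.PiG := fun z =>
    SemidirectCofinal.retraction_eq_one_iff M.φ M.isProSigmaCompletion hFT hFA z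
  -- `G = F` on `U`
  have hGF : ∀ u ∈ M.U, G u = F u := by
    have hcl : IsClosed ((G.eqLocus F : Subgroup M.P) : Set M.P) := isClosed_eq hGc hFc
    have hle : Subgroup.zpowers (M.ι (SemidirectProduct.inl (c 1 * c 2 : PuncturedSurfaceGroup 0 4)⁻¹ *
        SemidirectProduct.inr (Multiplicative.ofAdd (1 : ℤ)))) ≤ G.eqLocus F := by
      rw [Subgroup.zpowers_le]
      show G _ = F _
      apply Subtype.ext
      rw [hFι, hGι, MonoidHom.comp_apply, map_mul, SemidirectProduct.lift_inl, SemidirectProduct.lift_inr,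
        MonoidHom.one_apply, mul_one, hfw, hκv, map_mul, SemidirectProduct.rightHom_inl, SemidirectProduct.rightHom_inr,
        one_mul]
    exact fun u hu => (Subgroup.topologicalClosure_minimal _ hle hcl) hu
  refine ⟨G, hGc, ?_, ?_, ?_, ?_, ?_⟩
  · rw [hGι, MonoidHom.comp_apply, SemidirectProduct.lift_inl, hf3]
    exact Subtype.ext (hκv _)
  · rw [hGι, MonoidHom.comp_apply, SemidirectProduct.lift_inl, hf0, map_one]
  · rw [hGι, MonoidHom.comp_apply, SemidirectProduct.lift_inl, hf1, map_one]
  · -- trivial on `T`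
    have hker : IsClosed (G.ker : Set M.P) := by
      rw [MonoidHom.coe_ker]; exact isClosed_singleton.preimage hGc
    have hle : ((SemidirectProduct.inr : Multiplicative ℤ →* PuncturedSurfaceGroup 0 4 ⋊[M.φ] Multiplicative ℤ).range.map
        M.ι) ≤ G.ker := by
      rintro _ ⟨_, ⟨n, rfl⟩, rfl⟩
      rw [MonoidHom.mem_ker, hGι, MonoidHom.comp_apply, SemidirectProduct.lift_inr, MonoidHom.one_apply, map_one]
    intro t ht
    rw [Model.T] at ht
    exact (Subgroup.topologicalClosure_minimal _ hle hker) ht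
  · intro u hu hu1 h
    rw [hGF u hu] at h
    have : u ∈ M.U ⊓ M.PiG := ⟨hu, (hF1 u).mp h⟩
    rw [M.U_inf_PiG hne hprime, Subgroup.mem_bot] at this
    exact hu1 this


/-! ### KeyGen at the two vertices -/

/-- `ι(inl d)` commutes with `s` whenever `s` lies in a subgroup centralising a subgroup containing `ι(inl d)`.
[cite: MochizukiAbsTopII2013, Prop 1.3 (iii) p.11] -/
theorem conj_eq_of_le_centralizer {S K : Subgroup M.P} (hSK : S ≤ Subgroup.centralizer (K : Set M.P)) {s x : M.P}
    (hs : s ∈ S) (hx : x ∈ K) : s * x * s⁻¹ = x := by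
  rw [mul_inv_eq_iff_eq_mul]
  exact (Subgroup.mem_centralizer_iff.mp (hSK hs) x hx).symm

/-- `ι(inl c_j) ∈ ι(Π_{c_j})`. [cite: MochizukiCombGC2007, Def 1.1(ii) p.7] -/
theorem ι_inl_mem_cuspGp_map (j : Fin 4) :
    M.ι (SemidirectProduct.inl (c j)) ∈ (M.cuspGp j).map M.PiG.subtype := by
  rw [cuspGp_map_eq]; exact Subgroup.le_topologicalClosure _ (Subgroup.mem_zpowers _)

/-- `ι(inl c₁), ι(inl c₂) ∈ ι(Π_{v_A})`. [cite: MochizukiCombGC2007, Def 1.1(ii) p.6] -/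
theorem ι_inl_mem_vertGpA_map {d : PuncturedSurfaceGroup 0 4}
    (hd : d ∈ Subgroup.closure ({c 1, c 1 * c 2} : Set (PuncturedSurfaceGroup 0 4))) :
    M.ι (SemidirectProduct.inl d) ∈ (M.vertGpA).map M.PiG.subtype := by
  rw [vertGpA_map_eq]; exact Subgroup.le_topologicalClosure _ ⟨d, hd, rfl⟩

/-- **KeyGen at `v_A`: an element of `Π_𝔾` commuting with a NON-TRIVIAL element of `T = I_{v_A}` lies in `ι(Π_{v_A})`**,
every `Σ`, no hypothesis. [cite: MochizukiAbsTopII2013, Prop 1.3 (viii) p.12] -/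
theorem mem_vertGpA_of_commute_T {s : M.P} (hs : s ∈ M.T)
    (hs1 : s ≠ 1) {g : M.P} (hg : g ∈ M.PiG) (hcomm : g * s = s * g) : g ∈ (M.vertGpA).map M.PiG.subtype := by
  obtain ⟨b, hb⟩ := exists_freeGroupBasis_succ
  have hb0 : b 0 = c 1 := hb 0
  have hb1 : b 1 = c 2 := hb 1
  have hb2 : b 2 = c 3 := hb 2
  obtain ⟨χ, hχc, hχ1, hχ2, hχ3, hχT, hχU⟩ := M.exists_character_Tside
  have hs0 : s * M.ι (SemidirectProduct.inl (b 0)) * s⁻¹ = M.ι (SemidirectProduct.inl (b 0)) := by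
    rw [hb0]; exact M.conj_eq_of_le_centralizer M.T_le_centralizer_vertGpA hs (M.ι_inl_mem_vertGpA_map c_one_mem_closureA)
  have hs1' : s * M.ι (SemidirectProduct.inl (b 1)) * s⁻¹ = M.ι (SemidirectProduct.inl (b 1)) := by
    rw [hb1]; exact M.conj_eq_of_le_centralizer M.T_le_centralizer_vertGpA hs (M.ι_inl_mem_vertGpA_map c_two_mem_closureA)
  have hdec : ∀ n : ℕ, 0 < n → ∃ z₀ ∈ (Subgroup.zpowers (M.κG (b 0 * b 1))).topologicalClosure, ∃ υ : M.P,
      υ * M.ι (SemidirectProduct.inl (b 2)) * υ⁻¹ = M.ι (SemidirectProduct.inl (b 2)) ∧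
        s ^ n = (z₀ : M.P) * υ ∧ χ (z₀ : M.P) ≠ 1 := by
    intro n hn
    have hsn : s ^ n ∈ M.T := M.T.pow_mem hs n
    have hsnWU : s ^ n ∈ (M.nodeGp).map M.PiG.subtype ⊔ M.U := by
      rw [← T_sup_U_eq_WU]; exact Subgroup.mem_sup_left hsn
    obtain ⟨k, hk, u, hu, hku⟩ := M.exists_mul_of_mem_sup M.U_le_centralizer_W hsnWU
    obtain ⟨z₀, hz₀, rfl⟩ := hk
    refine ⟨z₀, ?_, u, ?_, hku, ?_⟩
    · rw [hb0, hb1, ← nodeGp_eq_closure_zpowers]; exact hz₀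
    · rw [hb2]; exact M.conj_eq_of_le_centralizer (M.U_le_centralizer_cuspGp M.twist_c_three) hu (M.ι_inl_mem_cuspGp_map 3)
    · intro h0
      have h1 : χ (s ^ n) = 1 := by
        rw [hku, map_mul, hχU u hu, mul_one]; exact h0
      rw [hχT _ hsn] at h1
      exact M.pow_ne_one_of_mem_T hs hs1 hn (congrArg Subtype.val h1)
  have h := M.mem_closure_of_commute_gen b hs0 hs1' χ hχc (by rw [hb0]; exact hχ1) (by rw [hb1]; exact hχ2)
    (by rw [hb2]; exact hχ3) hdec hg hcomm
  rw [hb0, hb1, closure_c_one_c_two] at h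
  rw [vertGpA_map_eq]
  exact h

/-- `ι(inl c₁c₂), ι(inl c₃), ι(inl c₀) ∈ ι(Π_{v_B})`. [cite: MochizukiCombGC2007, Def 1.1(ii) p.6] -/
theorem ι_inl_mem_vertGpB_map {d : PuncturedSurfaceGroup 0 4}
    (hd : d ∈ Subgroup.closure ({c 1 * c 2, c 3} : Set (PuncturedSurfaceGroup 0 4))) :
    M.ι (SemidirectProduct.inl d) ∈ (M.vertGpB).map M.PiG.subtype := by
  rw [vertGpB_map_eq]; exact Subgroup.le_topologicalClosure _ ⟨d, hd, rfl⟩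

/-- **KeyGen at `v_B`: an element of `Π_𝔾` commuting with a NON-TRIVIAL element of `U = I_{v_B}` lies in `ι(Π_{v_B})`**,
every `Σ`, no hypothesis. [cite: MochizukiAbsTopII2013, Prop 1.3 (viii) p.12] -/
theorem mem_vertGpB_of_commute_U (hne : Sigma.Nonempty) (hprime : ∀ p ∈ Sigma, p.Prime) {s : M.P} (hs : s ∈ M.U)
    (hs1 : s ≠ 1) {g : M.P} (hg : g ∈ M.PiG) (hcomm : g * s = s * g) : g ∈ (M.vertGpB).map M.PiG.subtype := by
  -- the free basis `(c₃, c₀, c₁)`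
  obtain ⟨b₀, hb₀⟩ := exists_freeGroupBasis_succ
  obtain ⟨b, hb⟩ := exists_freeGroupBasis_of_lifts b₀ ![b₀ 2, (b₀ 0 * b₀ 1 * b₀ 2)⁻¹, b₀ 0]
    ![b₀ 2, (b₀ 2)⁻¹ * (b₀ 1)⁻¹ * (b₀ 0)⁻¹, b₀ 0]
    (fun i => by fin_cases i <;> simp [mul_assoc])
    (fun i => by fin_cases i <;> simp [mul_assoc])
  have hb0 : b 0 = c 3 := by rw [hb]; simp [hb₀]
  have hb1 : b 1 = c 0 := by rw [hb, c_zero_eq_inv]; simp [hb₀]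
  have hb2 : b 2 = c 1 := by rw [hb]; simp [hb₀]
  have hw : (c 3 * c 0 : PuncturedSurfaceGroup 0 4) = (c 1 * c 2)⁻¹ := by rw [c_zero_eq_inv]; group
  obtain ⟨χ, hχc, hχ3, hχ0, hχ1, hχT, hχU⟩ := M.exists_character_Uside hne hprime
  have hs0 : s * M.ι (SemidirectProduct.inl (b 0)) * s⁻¹ = M.ι (SemidirectProduct.inl (b 0)) := by
    rw [hb0]; exact M.conj_eq_of_le_centralizer (M.U_le_centralizer_cuspGp M.twist_c_three) hs (M.ι_inl_mem_cuspGp_map 3)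
  have hs1' : s * M.ι (SemidirectProduct.inl (b 1)) * s⁻¹ = M.ι (SemidirectProduct.inl (b 1)) := by
    rw [hb1]; exact M.conj_eq_of_le_centralizer (M.U_le_centralizer_cuspGp M.twist_c_zero) hs (M.ι_inl_mem_cuspGp_map 0)
  have hdec : ∀ n : ℕ, 0 < n → ∃ z₀ ∈ (Subgroup.zpowers (M.κG (b 0 * b 1))).topologicalClosure, ∃ υ : M.P,
      υ * M.ι (SemidirectProduct.inl (b 2)) * υ⁻¹ = M.ι (SemidirectProduct.inl (b 2)) ∧
        s ^ n = (z₀ : M.P) * υ ∧ χ (z₀ : M.P) ≠ 1 := by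
    intro n hn
    have hsn : s ^ n ∈ M.U := M.U.pow_mem hs n
    have hsnWT : s ^ n ∈ (M.nodeGp).map M.PiG.subtype ⊔ M.T := by
      rw [← T_sup_U_eq_WT]; exact Subgroup.mem_sup_right hsn
    obtain ⟨k, hk, t, ht, hkt⟩ := M.exists_mul_of_mem_sup M.T_le_centralizer_W hsnWT
    obtain ⟨z₀, hz₀, rfl⟩ := hk
    refine ⟨z₀, ?_, t, ?_, hkt, ?_⟩
    · have hz : Subgroup.zpowers (M.κG (b 0 * b 1)) = Subgroup.zpowers (M.κG (c 1 * c 2)) := by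
        rw [hb0, hb1, hw, map_inv, Subgroup.zpowers_inv]
      rw [hz, ← nodeGp_eq_closure_zpowers]; exact hz₀
    · rw [hb2]; exact M.conj_eq_of_le_centralizer M.T_le_centralizer_vertGpA ht (M.ι_inl_mem_vertGpA_map c_one_mem_closureA)
    · intro h0
      have h1 : χ (s ^ n) = 1 := by
        rw [hkt, map_mul, hχT t ht, mul_one]; exact h0
      exact hχU _ hsn (M.pow_ne_one_of_mem_U hne hprime hs hs1 hn) h1
  have h := M.mem_closure_of_commute_gen b hs0 hs1' χ hχc (by rw [hb0]; exact hχ3) (by rw [hb1]; exact hχ0)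
    (by rw [hb2]; exact hχ1) hdec hg hcomm
  rw [hb0, hb1, closure_c_three_c_zero] at h
  rw [vertGpB_map_eq]
  exact h

/-! ### Prop 1.3 (viii), typed, no hypothesis -/

/-- **[AbsTopII] Prop 1.3 (viii) AS TYPED (`DPSCIndexData.Prop_1_3_viii'`) HOLDS at the two-vertex nodal DPSC datum,
every `Σ`, NO hypothesis**: for edges `e, e'` and `γ ∈ Π_𝔾` with `D_e ∩ γ D_{e'} γ⁻¹ ∩ Π_I ≠ 1`, either `e = e'` or
`e ≠ e'` abut to a common vertex `v`, `D_e ∩ γ D_{e'} γ⁻¹ ∩ Π_𝔾 = 1` and `h I_v h⁻¹ = D_e ∩ γ D_{e'} γ⁻¹ ∩ Π_I`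
with `h = 1` (KeyGen forces `γ ∈ Π_v`). [cite: MochizukiAbsTopII2013, Prop 1.3 (viii) p.12] -/
theorem prop_1_3_viii'_dpsc (hne : Sigma.Nonempty) (hprime : ∀ p ∈ Sigma, p.Prime) :
    Literature.AnabelianGeometry.AbsoluteAnabelian.AbsTopII.DPSCIndexData.Prop_1_3_viii' (M.dpsc hne hprime) :=
  M.prop_1_3_viii'_dpsc_of_keyGen hne hprime
    (fun _ hs hs1 _ hγ h => M.mem_vertGpA_of_commute_T hs hs1 hγ h)
    (fun _ hs hs1 _ hγ h => M.mem_vertGpB_of_commute_U hne hprime hs hs1 hγ h)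

/-- **ONE DPSC datum WITH TWO VERTICES carrying the typed [AbsTopII] Prop 1.3 (i) ∧ (ii)′ ∧ (iii) ∧ (iii)′ ∧ (iv)′ ∧
(iv)-«Moreover» ∧ (v) ∧ (v)′ ∧ (vi) ∧ (vii) ∧ (viii)′ ∧ (ix) SIMULTANEOUSLY, every nonempty set of primes `Σ`, NO
hypothesis.** [cite: MochizukiAbsTopII2013, Prop 1.3 p.11] -/
theorem exists_twoVertex_nodal_model_viii (Sigma : Set ℕ) (hne : Sigma.Nonempty) (hprime : ∀ p ∈ Sigma, p.Prime) :
    ∃ X : DPSCIndexData.{0}, X.Sigma = Sigma ∧ (∃ v v' : X.Vert, v ≠ v' ∧ X.Adjacent v v') ∧ Nonempty X.Node ∧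
      Literature.AnabelianGeometry.AbsoluteAnabelian.AbsTopII.DPSCIndexData.Prop_1_3_i X ∧
      Literature.AnabelianGeometry.AbsoluteAnabelian.AbsTopII.DPSCIndexData.Prop_1_3_ii' X ∧
      Literature.AnabelianGeometry.AbsoluteAnabelian.DPSCData.Prop13iii X.toDPSCData ∧
      Literature.AnabelianGeometry.AbsoluteAnabelian.AbsTopII.DPSCIndexData.Prop_1_3_iii' X ∧
      Literature.AnabelianGeometry.AbsoluteAnabelian.DPSCData.Prop13iv' X.toDPSCData ∧
      Literature.AnabelianGeometry.AbsoluteAnabelian.DPSCData.Prop13iv_moreover X.toDPSCData ∧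
      Literature.AnabelianGeometry.AbsoluteAnabelian.DPSCData.Prop13v X.toDPSCData ∧
      Literature.AnabelianGeometry.AbsoluteAnabelian.AbsTopII.DPSCIndexData.Prop_1_3_v' X ∧
      Literature.AnabelianGeometry.AbsoluteAnabelian.DPSCData.Prop13vi X.toDPSCData ∧
      Literature.AnabelianGeometry.AbsoluteAnabelian.DPSCData.Prop13vii X.toDPSCData ∧
      Literature.AnabelianGeometry.AbsoluteAnabelian.AbsTopII.DPSCIndexData.Prop_1_3_viii' X ∧
      Literature.AnabelianGeometry.AbsoluteAnabelian.DPSCData.Prop13ix X.toDPSCData := by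
  obtain ⟨M⟩ := Model.nonempty Sigma
  exact ⟨M.dpsc hne hprime, rfl, ⟨⟨(0 : Fin 2)⟩, ⟨(1 : Fin 2)⟩, M.vert_zero_ne_one hne hprime, M.adjacent_dpsc hne hprime _ _⟩,
    ⟨⟨()⟩⟩, M.prop_1_3_i_dpsc hne hprime, M.prop_1_3_ii'_dpsc hne hprime, M.prop13iii_dpsc hne hprime,
    M.prop_1_3_iii'_dpsc hne hprime, M.prop13iv'_dpsc hne hprime, M.prop13iv_moreover_dpsc hne hprime,
    M.prop13v_dpsc hne hprime, M.prop_1_3_v'_dpsc hne hprime, M.prop13vi_dpsc hne hprime, M.prop13vii_dpsc hne hprime,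
    M.prop_1_3_viii'_dpsc hne hprime, M.prop13ix_dpsc hne hprime⟩

end Literature.AnabelianGeometry.AbsoluteAnabelian.AbsTopII.TwoTripodNodal.Model

end
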